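import Summits.HodgeConjecture.HodgeConjecture.Theorems.R90S9HcoeffMemAtDatum          -- ★ p862450 (this seat): `hcoeffMem_gammaSph` (generic components map)
import Summits.HodgeConjecture.HodgeConjecture.Theorems.R90S9SphericalClassTuple        -- ★ p862412 (R90-IF-p02): `tupleOf`, `repOf`, `classOf_repOf`, `tupleOf_injective_of_letters`
import Summits.HodgeConjecture.HodgeConjecture.Theorems.R90S9TupleSupportOfRecord        -- ★ p862433 (R90-IF-p05): `tup_mem_supportOfRecord_of_spec`, `isCohUnitaryClass_clInfChoiceU_archDegOne`
import HarnessLib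

/-!
# R90-TF · S9 «InnerForm-13.3.6 (c)» — THE RE-CUT (CMP) BINDER `hcoeffMem` AT `Γ₀^{sph} = gammaSph X` ALONG THE COMPONENTS RECORD OF RECORD `tupleOf`
# (Rogawski 1990, proof of Thm. 14.6.4, p. 244 last display → p. 245 l. 2), the three `tup`-hypotheses of ★ `hcoeffMem_gammaSph` DISCHARGED by name

Cell `hodgecm-mathlib`, crux H413 (`stmt-HodgeConjecture-24833`, lane `--supports … --as helper`), route of record `HCCMUnconditional` (no route verbs;
count-neutral).  Programme R90-TF (HUMAN RULING «R90-TF SLAB — MAX PUSH»; brief `director/R90-BRIEF.v2.md` 1f40d54518340a35), section S9 = InnerForm-13.3.6 (c)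
(base `R90-IF`); seat R90-IF-p03 (g2); R90-IF-plan (g0) ruling S9-R-TG (2026-09-04T22:14:33Z): «import p02's Tuple file the minute it is ★» — ★ p862412 landed, so
the generic `tup` of ★ `hcoeffMem_gammaSph` is specialised to ★ `InnerFormSec146.tupleOf` and its three hypotheses are paid: the `clFinChoice`-specification (`repOf`,
`classOf_repOf`, `tupleOf_snd = rfl`), the injectivity (★ `tupleOf_injective_of_letters` — letters F1b + «ARCH» BY NAME, `hdef`, `hanis`), the support «of record»
(★ `tup_mem_supportOfRecord_of_spec`, R90-IF-p05, with ★ `isCohUnitaryClass_clInfChoiceU_archDegOne`; unit tests reading `1` on spherical admissible classes a.e.,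
`he1`).  THEOREMS ONLY: no `def`, no instance, no notation, no named fact, no `sorry`; imports ★ only; namespace `Summit.HodgeConjecture.HodgeConjecture.R90.S9`.
HONEST LABEL: HC_CM is proved only modulo the 7 printed citations (2 remaining named inputs: hLiu418 = stmt-HodgeConjecture-24832, h413 = stmt-HodgeConjecture-24833)
— until rung 0 closes.  Bookkeeping instantiation; proves no printed statement about automorphic forms.  REMAINING NAMED INPUTS of the (CMP) binder at `Γ₀^{sph}`
after this file: the pin `htrX : X.trPrime = Θ₀ ∘ tupleOf` (`rfl` at `X_cm`, S9-R-TG), the letters F1b («tensor-product uniqueness») and «ARCH» (archimedean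
component of a discrete representation), the slot letters on `Π′(ξ_v)` (`ha₀ hun hus hsph hne`), the exceptional sets with the two local laws and the truncated-product
local identities (`T₀ hn1 hs0 hR₁ hR₂` — S2 ∕ S3 ∕ S7), (14.6.3) in `HasSum` form (`h63` — R90-IF-p07 ★ p862382 at `Γ₀`) and transfer existence (`hex` — S6).

[cite: Rogawski1990, §14.6 Thm. 14.6.4 and its proof pp. 244–245 (chunks p0238 L9 – p0239 L4); Prop. 13.8.1 p. 206; §14.5 p. 237] [cite: FlathCorvallis1979, Thm. 3 and Thm. 4]
[cite: JacquetLanglands1970, Lemma 16.1.1 pp. 497–499]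
-/

set_option autoImplicit false
-- the mandated namespace repeats `HodgeConjecture.HodgeConjecture`, as in every `Theorems/*.lean` of this sub-problem
set_option linter.dupNamespace false

noncomputable section

namespace Summit.HodgeConjecture.HodgeConjecture.R90.S9

open Finset
open Literature.NumberTheory.Automorphic
open NumberField IsDedekindDomain MeasureTheory
open Literature.NumberTheory.Rogawski1990 Literature.NumberTheory.Automorphic.UnitaryGroup
open Literature.NumberTheory.Automorphic.UnitaryGroup.CotangentForms (cmCompactFactor)
open Literature.RepresentationTheory.KonnoKonno2007 Literature.RepresentationTheory.KonnoKonno2007.RealDualPair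
open Literature.RepresentationTheory.KonnoKonno2007.RealDualPair.UForm
open Summit.HodgeConjecture.HodgeConjecture.Cruxes.H413 Summit.HodgeConjecture.HodgeConjecture.Cruxes.H413.F0P3ClassTokenChoice
open Summit.HodgeConjecture.HodgeConjecture.Cruxes.H413.F0P3GlobalPacket Summit.HodgeConjecture.HodgeConjecture.Cruxes.H413.F0P3LocalPacketKit
open Summit.HodgeConjecture.HodgeConjecture.Cruxes.H413.F0P3UnitaryLocOfRecord (IsCohUnitaryClass)
open InnerFormSec146
open scoped Matrix Classical ComplexOrder

section Datum

variable (L : Type) [Field L] [NumberField L] [IsCMField L] (ι₀ : L →+* ℂ) (H : Matrix (Fin 3) (Fin 3) L)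
  (T : GL (Fin 3) ℂ) (hT : (T : Matrix (Fin 3) (Fin 3) ℂ)ᴴ * H.map ι₀ * (T : Matrix (Fin 3) (Fin 3) ℂ) = Literature.Geometry.ComplexHyperbolic.BallModel.J)
  (νinf : @Measure (UnitaryGroup.arch (↥(maximalRealSubfield L)) L (IsCMField.complexConj L) 3 H) (borel _))
  (μv : ∀ v : HeightOneSpectrum (𝓞 ↥(maximalRealSubfield L)), @Measure ((cmDatum L 3 H).Local v) (borel _))
  (hdef : ∀ τ' : L →+* ℂ, InfinitePlace.mk τ' ≠ InfinitePlace.mk ι₀ → (H.map τ').PosDef)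
  (hν : @Measure.IsHaarMeasure _ _ _ (borel _) νinf)
  (hμ : ∀ v : HeightOneSpectrum (𝓞 ↥(maximalRealSubfield L)), @Measure.IsHaarMeasure _ _ _ (borel _) (μv v))
  (e : ∀ v : HeightOneSpectrum (𝓞 ↥(maximalRealSubfield L)), (cmDatum L 3 H).Local v → ℂ)
  (he : ∀ v, IsLocallyConstant (e v) ∧ HasCompactSupport (e v))
  {TG TH : Type}
  (μA : Measure (adelicGroupData (↥(maximalRealSubfield L)) L (IsCMField.complexConj L) 3 H).automorphicQuotient)
  [(adelicGroupData (↥(maximalRealSubfield L)) L (IsCMField.complexConj L) 3 H).IsAutomorphicMeasure μA]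
  (Ξ : OneDimAutRepH L → PacketPrimeFin L H) {H' : Matrix (Fin 3) (Fin 3) L}
  (𝔩 : ∀ v : HeightOneSpectrum (𝓞 ↥(maximalRealSubfield L)), LocalPacketKit L H' v)

include hdef hν hμ he in
/-- **`hcoeffMem` AT `Γ₀^{sph} = gammaSph X`, ALONG `tupleOf`** — ★ `hcoeffMem_gammaSph` with the components map specialised to the record ★ `InnerFormSec146.tupleOf`
(R90-IF-p02: archimedean coordinate ★ `clInfChoiceU` through the frame, finite coordinates ★ `clFinChoice` on the representative of record `repOf`), its three
hypotheses PAID: `hspec` by `repOf` ∕ `classOf_repOf` ∕ `rfl`; `htupInj` by ★ `tupleOf_injective_of_letters` under the letters F1b (`hF1b`, «a `K_c`-spherical discrete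
representation is determined by its components», [FlathCorvallis1979, Thms. 3–4]) and «ARCH» (`hARCH`, the archimedean component of a discrete representation) BY
NAME; `htupW₀` by ★ `tup_mem_supportOfRecord_of_spec` (R90-IF-p05) from the unit-test law `he1` («`Tr c(e_v) = 1` for spherical admissible `c`, almost every `v`»;
for the normalised units `e_v = μ_v(K_v)⁻¹ 𝟙_{K_v}` this is ★ `eventually_smoothTrace_unit_eq_one_of_isSpherical`).  Everything else as in ★ `hcoeffMem_gammaSph`
(pin `htrX` now reading `X.trPrime π′ = Θ₀ (tupleOf π′)`; slot letters; `T₀ hn1 hs0 hR₁ hR₂`; `h63`; `hex`).  CONCLUSION (Γ-field spelling, `Γ := gammaSph … X`):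
`∀ π′, Γ.evpRep π′ P → Γ.m′ π′ ≠ 0 → Γ.mem′ π′ (Γ.PiXi′ ξ h₁ hS)` — the `hcoeffMem` binder of ★ `sec146_of_parts_mem` at the datum.
[cite: Rogawski1990, §14.6 Thm. 14.6.4 and its proof pp. 244–245 (chunks p0238 L9 – p0239 L4); Prop. 13.8.1 p. 206; §14.5 p. 237] [cite: FlathCorvallis1979, Thm. 3 and Thm. 4] -/
theorem hcoeffMem_gammaSph_tupleOf
    (hanis : ∀ x : Fin 3 → L, Literature.AlgebraicGeometry.ShimuraVarieties.hermForm (cmConjRingHom L) H x x = 0 → x = 0)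
    -- the letters F1b + «ARCH» [FlathCorvallis1979, Thms. 3–4; HarishChandra1953] and the unit-test law [GetzHahn2024, Cor. 5.5.2]
    (hF1b : ∀ P₀ Q₀ : DiscreteAutomorphicRep (adelicGroupData (↥(maximalRealSubfield L)) L (IsCMField.complexConj L) 3 H) μA,
      IsKcSpherical L ι₀ H T hT μA P₀ → IsKcSpherical L ι₀ H T hT μA Q₀ →
      P₀.UnitaryEquivOfComponents Q₀ (uFormGroup (Fin 2) (Fin 1)) (cmArchSectionUForm L ι₀ H T hT) (cmCompactFactor L ι₀ H T hT))
    (hARCH : ArchComponentOfDiscrete L ι₀ H T hT μA)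
    (he1 : ∀ᶠ v : HeightOneSpectrum (𝓞 ↥(maximalRealSubfield L)) in Filter.cofinite, ∀ c : IrrClass ((cmDatum L 3 H).Local v),
      c.IsAdmissible → c.IsSpherical (cmLocalIntegralLevel L 3 H v) →
        (letI : MeasurableSpace ((cmDatum L 3 H).Local v) := borel _; c.smoothTrace (μv v) (e v)) = 1)
    (X : DatumInputs ((UnitaryGroup.arch (↥(maximalRealSubfield L)) L (IsCMField.complexConj L) 3 H → ℂ) ×
        (∀ v : HeightOneSpectrum (𝓞 ↥(maximalRealSubfield L)), (cmDatum L 3 H).Local v → ℂ)) TG TH L ι₀ H T hT μA Ξ 𝔩)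
    (Transfer : (UnitaryGroup.arch (↥(maximalRealSubfield L)) L (IsCMField.complexConj L) 3 H → ℂ) ×
        (∀ v : HeightOneSpectrum (𝓞 ↥(maximalRealSubfield L)), (cmDatum L 3 H).Local v → ℂ) → TG → Prop)
    (TransferH : (UnitaryGroup.arch (↥(maximalRealSubfield L)) L (IsCMField.complexConj L) 3 H → ℂ) ×
        (∀ v : HeightOneSpectrum (𝓞 ↥(maximalRealSubfield L)), (cmDatum L 3 H).Local v → ℂ) → TH → Prop)
    -- the pin «`tr′ = Θ₀ ∘ tupleOf`» (ruling S9-R-TG; `rfl` at `X_cm`)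
    (htrX : ∀ (π' : RepPrimeSph L ι₀ H T hT μA) (φf : (UnitaryGroup.arch (↥(maximalRealSubfield L)) L (IsCMField.complexConj L) 3 H → ℂ) ×
        (∀ v : HeightOneSpectrum (𝓞 ↥(maximalRealSubfield L)), (cmDatum L 3 H).Local v → ℂ)),
      X.trPrime π' φf = archTr₀ L ι₀ H T hT νinf (tupleOf L ι₀ H T hT μA π').1 φf.1 *
        ∏ᶠ v, (letI : MeasurableSpace ((cmDatum L 3 H).Local v) := borel _;
          ((tupleOf L ι₀ H T hT μA π').2 v).smoothTrace (μv v) (φf.2 v)))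
    {P : X.G.Packet} {ξ : X.G.PacketH} (h₁ : X.IsOneDimH ξ) (hS : ∀ q : InnerFormSec146.Place L, q ∈ S0 L H → X.MnNeZero ξ q)
    (p : HeightOneSpectrum (𝓞 ↥(maximalRealSubfield L)) → Prop)
    (a₀ : GKIrrClass (uFormGroup (Fin 2) (Fin 1)))
    (ha₀ : ∃ r : GKIrrep (uFormGroup (Fin 2) (Fin 1)), GKIrrClass.mk r = a₀ ∧ IsAdmissibleGK r.ρK ∧ r.IsInfUnitaryAlongP)
    (hun : ∀ v, ((Ξ (X.oneDimOf ξ h₁) v).πn).IsUnitarizable)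
    (hus : ∀ v, p v → ((Ξ (X.oneDimOf ξ h₁) v).πs.getD (Ξ (X.oneDimOf ξ h₁) v).πn).IsUnitarizable)
    (hsph : {v | (letI : MeasurableSpace ((cmDatum L 3 H).Local v) := borel _;
      ((Ξ (X.oneDimOf ξ h₁) v).πn).smoothTrace (μv v) (e v)) ≠ 1}.Finite)
    (hne : ∀ i : {v // p v}, (Ξ (X.oneDimOf ξ h₁) (i : _)).πs.getD (Ξ (X.oneDimOf ξ h₁) (i : _)).πn ≠ (Ξ (X.oneDimOf ξ h₁) (i : _)).πn)
    (T₀ : (UnitaryGroup.arch (↥(maximalRealSubfield L)) L (IsCMField.complexConj L) 3 H → ℂ) ×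
        (∀ v : HeightOneSpectrum (𝓞 ↥(maximalRealSubfield L)), (cmDatum L 3 H).Local v → ℂ) →
      Finset (HeightOneSpectrum (𝓞 ↥(maximalRealSubfield L))))
    (hn1 : ∀ φf, (ArchTestKc L ι₀ H T hT φf.1 ∧ (∀ v, IsLocallyConstant (φf.2 v) ∧ HasCompactSupport (φf.2 v)) ∧ {v | φf.2 v ≠ e v}.Finite) →
      ∀ v ∉ T₀ φf, (letI : MeasurableSpace ((cmDatum L 3 H).Local v) := borel _;
        ((Ξ (X.oneDimOf ξ h₁) v).πn).smoothTrace (μv v) (φf.2 v)) = 1)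
    (hs0 : ∀ φf, (ArchTestKc L ι₀ H T hT φf.1 ∧ (∀ v, IsLocallyConstant (φf.2 v) ∧ HasCompactSupport (φf.2 v)) ∧ {v | φf.2 v ≠ e v}.Finite) →
      ∀ i : {v // p v}, (i : HeightOneSpectrum (𝓞 ↥(maximalRealSubfield L))) ∉ T₀ φf →
        (letI : MeasurableSpace ((cmDatum L 3 H).Local i) := borel _;
          ((Ξ (X.oneDimOf ξ h₁) (i : _)).πs.getD (Ξ (X.oneDimOf ξ h₁) (i : _)).πn).smoothTrace (μv i) (φf.2 i)) = 0)
    (hR₁ : ∀ φf (f : TG), (ArchTestKc L ι₀ H T hT φf.1 ∧ (∀ v, IsLocallyConstant (φf.2 v) ∧ HasCompactSupport (φf.2 v)) ∧ {v | φf.2 v ≠ e v}.Finite) →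
      Transfer φf f →
      X.G.packetTrace X.tr P f =
        (-1) ^ (gammaSph _ TG TH L ι₀ H T hT μA Ξ 𝔩 X).N *
          (archTr₀ L ι₀ H T hT νinf a₀ φf.1 *
            ∏ v ∈ T₀ φf with ¬ p v, (letI : MeasurableSpace ((cmDatum L 3 H).Local v) := borel _;
              ((Ξ (X.oneDimOf ξ h₁) v).πn).smoothTrace (μv v) (φf.2 v))) *
          ∏ i ∈ (T₀ φf).subtype p, (letI : MeasurableSpace ((cmDatum L 3 H).Local i) := borel _;
            (((Ξ (X.oneDimOf ξ h₁) (i : _)).πn).smoothTrace (μv i) (φf.2 i) -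
              ((Ξ (X.oneDimOf ξ h₁) (i : _)).πs.getD (Ξ (X.oneDimOf ξ h₁) (i : _)).πn).smoothTrace (μv i) (φf.2 i))))
    (hR₂ : ∀ φf (fH : TH), (ArchTestKc L ι₀ H T hT φf.1 ∧ (∀ v, IsLocallyConstant (φf.2 v) ∧ HasCompactSupport (φf.2 v)) ∧ {v | φf.2 v ≠ e v}.Finite) →
      TransferH φf fH →
      X.trH ξ fH =
        (-1) ^ (gammaSph _ TG TH L ι₀ H T hT μA Ξ 𝔩 X).N * (gammaSph _ TG TH L ι₀ H T hT μA Ξ 𝔩 X).c *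
          (archTr₀ L ι₀ H T hT νinf a₀ φf.1 *
            ∏ v ∈ T₀ φf with ¬ p v, (letI : MeasurableSpace ((cmDatum L 3 H).Local v) := borel _;
              ((Ξ (X.oneDimOf ξ h₁) v).πn).smoothTrace (μv v) (φf.2 v))) *
          ∏ i ∈ (T₀ φf).subtype p, (letI : MeasurableSpace ((cmDatum L 3 H).Local i) := borel _;
            (((Ξ (X.oneDimOf ξ h₁) (i : _)).πn).smoothTrace (μv i) (φf.2 i) +
              ((Ξ (X.oneDimOf ξ h₁) (i : _)).πs.getD (Ξ (X.oneDimOf ξ h₁) (i : _)).πn).smoothTrace (μv i) (φf.2 i))))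
    (h63 : ∀ φf, (ArchTestKc L ι₀ H T hT φf.1 ∧ (∀ v, IsLocallyConstant (φf.2 v) ∧ HasCompactSupport (φf.2 v)) ∧ {v | φf.2 v ≠ e v}.Finite) →
      ∀ (f : TG) (fH : TH), Transfer φf f → TransferH φf fH →
      HasSum (fun π' => {π' : (gammaSph _ TG TH L ι₀ H T hT μA Ξ 𝔩 X).Rep' | (gammaSph _ TG TH L ι₀ H T hT μA Ξ 𝔩 X).evpRep π' P}.indicator
          (fun π' => ((gammaSph _ TG TH L ι₀ H T hT μA Ξ 𝔩 X).m' π' : ℂ) * (gammaSph _ TG TH L ι₀ H T hT μA Ξ 𝔩 X).tr' π' φf) π')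
        (1 / 2 * X.G.packetTrace X.tr P f + 1 / 2 * X.trH ξ fH))
    (hex : ∀ φf, (ArchTestKc L ι₀ H T hT φf.1 ∧ (∀ v, IsLocallyConstant (φf.2 v) ∧ HasCompactSupport (φf.2 v)) ∧ {v | φf.2 v ≠ e v}.Finite) →
      ∃ (f : TG) (fH : TH), Transfer φf f ∧ TransferH φf fH) :
    ∀ π' : (gammaSph _ TG TH L ι₀ H T hT μA Ξ 𝔩 X).Rep',
      (gammaSph _ TG TH L ι₀ H T hT μA Ξ 𝔩 X).evpRep π' P → (gammaSph _ TG TH L ι₀ H T hT μA Ξ 𝔩 X).m' π' ≠ 0 →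
        (gammaSph _ TG TH L ι₀ H T hT μA Ξ 𝔩 X).mem' π' ((gammaSph _ TG TH L ι₀ H T hT μA Ξ 𝔩 X).PiXi' ξ h₁ hS) := by
  -- the `clFinChoice`-specification of `tupleOf` on the representative of record
  have hspec : ∀ π' : RepPrimeSph L ι₀ H T hT μA,
      ∃ P₀ : DiscreteAutomorphicRep (adelicGroupData (↥(maximalRealSubfield L)) L (IsCMField.complexConj L) 3 H) μA,
        classOf L H μA P₀ = π'.1 ∧ ∀ v, (tupleOf L ι₀ H T hT μA π').2 v = clFinChoice P₀ v :=
    fun π' => ⟨repOf L H μA π'.1, classOf_repOf L H μA π'.1, fun v => rfl⟩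
  -- the support «of record» (R90-IF-p05): coh-unitary archimedean coordinate + chosen finite classes
  have hW₀ := tup_mem_supportOfRecord_of_spec L H μA hanis μv e he1 (tupleOf L ι₀ H T hT μA) Set.univ
    (fun π' _ => isCohUnitaryClass_clInfChoiceU_archDegOne L H μA ι₀ T hT (repOf L H μA π'.1))
    (fun π' _ => ⟨repOf L H μA π'.1, fun v => rfl⟩)
  exact hcoeffMem_gammaSph L ι₀ H T hT νinf μv hdef hν hμ e he μA Ξ 𝔩 hanis X Transfer TransferH (tupleOf L ι₀ H T hT μA) hspec
    (tupleOf_injective_of_letters L ι₀ H T hT μA hdef hanis hF1b hARCH) (fun π' => hW₀ π' (Set.mem_univ _)) htrX h₁ hS p a₀ ha₀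
    hun hus hsph hne T₀ hn1 hs0 hR₁ hR₂ h63 hex

end Datum

end Summit.HodgeConjecture.HodgeConjecture.R90.S9

end
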